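import Summits.NavierStokesRegularity.NavierStokesRegularity.Theorems.ExtremiserTransienceLocalMaximiserExtraction
import Summits.NavierStokesRegularity.NavierStokesRegularity.Theorems.ExtremiserTransienceTwoThirdsTypicalSlices
import Summits.NavierStokesRegularity.NavierStokesRegularity.Theorems.ExtremiserTransienceTwoThirdsGoodBallsLimit
import HarnessLib

/-!
# Route `ExtremiserTransience`, crux `NearExtremalTransiencePerFlow` (stmt-NavierStokesRegularity-26567),
# LINE g10-1 `two_thirds` (ns-idea-10 g10): S1b `ExtremalExtraction` PROVED (conditional on S1a, as registered)

`--supports stmt-NavierStokesRegularity-26567 --as helper`.  `extremalExtraction_holds : ExtremalExtraction` — the by-text stub S1b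
`stub_extremalExtraction : Sig.ExtremalExtraction` of `Cruxes/NearExtremalTransience/Lines/two_thirds.lean` (REV 1.2, 9b1e29b3e15f) over the
texts of record `…TwoThirdsDefs` (p719439).  It is the landed L3 extraction `LocalMaximiser.extraction_holds` (p713234) RE-RUN at the S1a
centres: the typical slices `TwoThirds.exists_typical_slices` (p720040) replace `exists_selected_slices`; the zoom, the package subsequences,
the pointwise convergence `Vn → V`, the uniform derivative budgets, the robust local maximality, the linear growth, analyticity and
divergence-freeness of the limit are VERBATIM the L3 assembly; what is new is only the last step — the slice-level good balls become good balls of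
the normalised slices `Vn n` in cell units (`TwoThirds.isGoodBall_azoom_of_isGoodBallAt`, `norm_cell_centre_le`, p719884), the thickness
`‖curl (Vn n) 0‖ ≥ θ₀` is kept quantitatively, and the limit extraction lemma `TwoThirds.exists_doubling_goodBalls_of_limit` (p720164) delivers
`K, b₀ = Z_{B(0,1/2)}(V) > 0, D = 4^{10}` and, for every `i₀`, a scale `i ≥ i₀` with a `D`-doubling good ball `B(c,r)`, `r ∈ [4^i, 2·4^i]`,
tolerance `K/(i+1)`, `Z_{B(c,r)} ≥ b₀`.

HONEST FRAMING: S1b is conditional on S1a `TypicalSelection` (its hypothesis, OPEN, L) exactly as registered; S2, the crux ⟨26567⟩ and NS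
regularity are OPEN; nothing about Navier–Stokes regularity or blow-up is proved; no summit is proved by a line.
[cite: KochNadirashviliSereginSverak2009, Prop. 4.1 and Lemma 6.1 (arXiv:0709.3599 pp. 8, 11)] -/

noncomputable section

open scoped Topology InnerProductSpace RealInnerProductSpace ENNReal ContDiff
open MeasureTheory Filter Set Metric Function
open Literature.Analysis Literature.Analysis.FluidPDE
open Summit.NavierStokesRegularity.NavierStokesRegularity.Theorems.DepletionLadder.KStar.HalfSpace
open Summit.NavierStokesRegularity.NavierStokesRegularity.Theorems.DepletionLadder.KStar.BangBang

namespace Summit.NavierStokesRegularity.NavierStokesRegularity.Theorems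

-- the summit's namespace repeats the problem name by convention (D-0017)
set_option linter.dupNamespace false

namespace NearExtremalTransiencePerFlow.TwoThirds

section Assembly

open DepletionLadder.KStar
open NearExtremalTransiencePerFlow.ZoneTransversality NearExtremalTransiencePerFlow.MemberSelection
open NearExtremalTransiencePerFlow.LocalMaximiser
open Literature.Analysis.Calculus

/-- **S1b `ExtremalExtraction`** (LINE g10-1 `two_thirds`): given S1a, every violator flow yields a field of the limit class
`InLimitClass A A_E V` which carries, at infinitely many 4-adic scales, a `4^{10}`-doubling good ball of enstrophy `≥ b₀ > 0`
(see the module docstring; the L3 zoom re-run at the S1a centres plus `exists_doubling_goodBalls_of_limit`).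
[cite: KochNadirashviliSereginSverak2009, Prop. 4.1 and Lemma 6.1 (arXiv:0709.3599 pp. 8, 11)] -/
theorem extremalExtraction_holds : ExtremalExtraction := by
  intro hSel C ν T u p hV
  have hV' := hV
  obtain ⟨hC, hν, hT, hsol, hLH, hdec, hrate, hext, hnot⟩ := hV'
  -- ### Part 4 data and the package
  obtain ⟨A, θ₀, Ktol, r_lo, r_hi, Θ_T, t, M, lamn, ε', x₀, σ, hA1, hθ₀, hKpos, hr_lo, hr_lohi, htn, hσ, hwcd, hwM, hlamdef, hlam0,
    hr, hReg, hthick, htest, htyp, hD⟩ := exists_typical_slices hSel hV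
  have htI : ∀ n, t n ∈ Set.Ico 0 T := hD.1
  have htT : Tendsto t atTop (𝓝 T) := hD.2.1
  have hMpos : ∀ n, 0 < M n := hD.2.2.2.1
  obtain ⟨A_F0, hAF0⟩ := FilamentGap.flowFilamentBudget C ν T hC hν hT u p hsol hLH hdec hrate
  set A_F : ℝ := max A_F0 1 with hAFdef
  have hAFpos : 0 < A_F := lt_of_lt_of_le one_pos (le_max_right _ _)
  have hAF : ∀ᶠ t' in 𝓝[<] T, ∀ (x : EuclideanSpace ℝ (Fin 3)) (r : ℝ), 0 < r →
      ∫ y in Metric.ball x r, ‖u t' y‖ ^ 2 ≤ A_F * ν ^ 2 * r := by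
    filter_upwards [hAF0] with t' ht' x r hr'
    exact (ht' x r hr').trans (mul_le_mul_of_nonneg_right (mul_le_mul_of_nonneg_right (le_max_left _ _) (sq_nonneg ν)) hr'.le)
  obtain ⟨σ₀, Λ, Θ'', ε'', hσ₀, hfam, hcomp⟩ := stub_zoomPackage C ν T u p hV Θ_T t M ε' hD
  -- ### centres in package coordinates, compactness, the scale ratio, the sign
  set y : ℕ → EuclideanSpace ℝ (Fin 3) := fun k => (M (σ₀ k) / ν) • x₀ (σ₀ k) with hydef
  obtain ⟨ψ, K, s, W, hψ, hW, hs, hconv⟩ := hcomp y id strictMono_id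
  simp only [id] at hconv
  set r : ℕ → ℝ := fun k => lamn k * M k / ν with hrdef
  obtain ⟨rinf, hrinfmem, χ, hχ, hrconv⟩ := tendsto_subseq_of_bounded (Metric.isBounded_Icc r_lo r_hi)
    (x := fun n => r (σ₀ (ψ n))) (fun n => ⟨(hr _).1, (hr _).2⟩)
  rw [closure_Icc] at hrinfmem
  have hrinfpos : 0 < rinf := lt_of_lt_of_le hr_lo hrinfmem.1
  obtain ⟨sgn, ξ, hξ, hsgn, hσξ⟩ : ∃ (sgn : ℝ) (ξ : ℕ → ℕ), StrictMono ξ ∧ (sgn = 1 ∨ sgn = -1) ∧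
      ∀ n, σ (σ₀ (ψ (χ (ξ n)))) = sgn := by
    by_cases hfr : ∃ᶠ n in atTop, σ (σ₀ (ψ (χ n))) = 1
    · obtain ⟨ξ, hξ, hξ'⟩ := extraction_of_frequently_atTop hfr
      exact ⟨1, ξ, hξ, Or.inl rfl, hξ'⟩
    · have hev : ∀ᶠ n in atTop, σ (σ₀ (ψ (χ n))) = -1 := by
        rw [not_frequently] at hfr
        filter_upwards [hfr] with n hn
        exact (hσ _).resolve_left hn
      obtain ⟨ξ, hξ, hξ'⟩ := extraction_of_frequently_atTop hev.frequently
      exact ⟨-1, ξ, hξ, Or.inr rfl, hξ'⟩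
  have hsgnabs : |sgn| = 1 := by rcases hsgn with h | h <;> simp [h]
  have hsgnne : sgn ≠ 0 := by rcases hsgn with h | h <;> simp [h]
  -- ### indices
  set pn : ℕ → ℕ := fun n => ψ (χ (ξ n)) with hpndef
  set ι : ℕ → ℕ := fun n => σ₀ (pn n) with hιdef
  have hpn : StrictMono pn := hψ.comp (hχ.comp hξ)
  have hι : StrictMono ι := hσ₀.comp hpn
  have hιn : ∀ n, n ≤ ι n := fun n => hι.id_le n
  have hr' : Tendsto (fun n => r (ι n)) atTop (𝓝 rinf) := hrconv.comp hξ.tendsto_atTop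
  have hσι : ∀ n, σ (ι n) = sgn := hσξ
  -- ### the fields
  set w : ℕ → EuclideanSpace ℝ (Fin 3) → EuclideanSpace ℝ (Fin 3) := fun n x => σ (ι n) • u (t (ι n)) x with hwdef
  set Vn : ℕ → EuclideanSpace ℝ (Fin 3) → EuclideanSpace ℝ (Fin 3) :=
    fun n => azoom (M (ι n))⁻¹ (lamn (ι n)) (x₀ (ι n)) (w n) with hVndef
  set V : EuclideanSpace ℝ (Fin 3) → EuclideanSpace ℝ (Fin 3) := azoom sgn rinf 0 (W s) with hVdef
  have hWs : ContDiff ℝ (⊤ : ℕ∞) (W s) := hW.contDiff_slice hs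
  -- the package translates and the key identity `Vn n x = sgn • Vpkg (pn n) (y (pn n) + r (ι n) • x)`
  have hkey : ∀ n x, Vn n x = sgn • ((M (σ₀ (pn n)))⁻¹ • u (t (σ₀ (pn n))) ((ν / M (σ₀ (pn n))) • (y (pn n) + r (ι n) • x))) := by
    intro n x
    have hM0 : M (σ₀ (pn n)) ≠ 0 := (hMpos _).ne'
    have hν0 : ν ≠ 0 := hν.ne'
    have c1 : ν / M (σ₀ (pn n)) * (M (σ₀ (pn n)) / ν) = 1 := by field_simp
    have c2 : ν / M (σ₀ (pn n)) * (lamn (σ₀ (pn n)) * M (σ₀ (pn n)) / ν) = lamn (σ₀ (pn n)) := by field_simp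
    have e1 : (ν / M (σ₀ (pn n))) • (y (pn n) + r (ι n) • x) = x₀ (ι n) + lamn (ι n) • x := by
      simp only [hydef, hrdef, hιdef, smul_add, smul_smul, c1, c2, one_smul]
    rw [e1]
    show azoom (M (ι n))⁻¹ (lamn (ι n)) (x₀ (ι n)) (w n) x = _
    rw [azoom_apply]
    show (M (ι n))⁻¹ • (σ (ι n) • u (t (ι n)) (x₀ (ι n) + lamn (ι n) • x)) = _
    rw [hσι n, smul_comm]
  -- ### pointwise convergence `Vn n x → V x`
  have hLip : ∀ k (a b : EuclideanSpace ℝ (Fin 3)),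
      ‖(M (σ₀ k))⁻¹ • u (t (σ₀ k)) ((ν / M (σ₀ k)) • a) - (M (σ₀ k))⁻¹ • u (t (σ₀ k)) ((ν / M (σ₀ k)) • b)‖ ≤ Λ 1 * ‖a - b‖ := by
    intro k a b
    have hdiff : ∀ z ∈ (Set.univ : Set (EuclideanSpace ℝ (Fin 3))),
        DifferentiableAt ℝ (fun y' => (M (σ₀ k))⁻¹ • u (t (σ₀ k)) ((ν / M (σ₀ k)) • y')) z :=
      fun z _ => ((hfam.1 k).differentiable (by simp)).differentiableAt
    have hbd : ∀ z ∈ (Set.univ : Set (EuclideanSpace ℝ (Fin 3))),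
        ‖fderiv ℝ (fun y' => (M (σ₀ k))⁻¹ • u (t (σ₀ k)) ((ν / M (σ₀ k)) • y')) z‖ ≤ Λ 1 := fun z _ => by
      rw [← norm_iteratedFDeriv_one]; exact hfam.2.2.2.1 1 k z
    exact (convex_univ.norm_image_sub_le_of_norm_fderiv_le hdiff hbd (Set.mem_univ b) (Set.mem_univ a))
  have hptV : ∀ x, Tendsto (fun n => Vn n x) atTop (𝓝 (V x)) := by
    intro x
    have h2 : Tendsto (fun n => (M (σ₀ (pn n)))⁻¹ • u (t (σ₀ (pn n))) ((ν / M (σ₀ (pn n))) • (y (pn n) + rinf • x))) atTop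
        (𝓝 (W s (rinf • x))) := (hconv (rinf • x)).comp (hχ.comp hξ).tendsto_atTop
    rw [tendsto_iff_norm_sub_tendsto_zero]
    have hbound : ∀ n, ‖Vn n x - V x‖ ≤ Λ 1 * (|r (ι n) - rinf| * ‖x‖) +
        ‖(M (σ₀ (pn n)))⁻¹ • u (t (σ₀ (pn n))) ((ν / M (σ₀ (pn n))) • (y (pn n) + rinf • x)) - W s (rinf • x)‖ := by
      intro n
      rw [hkey n x, hVdef, azoom_apply, zero_add, ← smul_sub, norm_smul, Real.norm_eq_abs, hsgnabs, one_mul]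
      refine (norm_sub_le_norm_sub_add_norm_sub _
        ((M (σ₀ (pn n)))⁻¹ • u (t (σ₀ (pn n))) ((ν / M (σ₀ (pn n))) • (y (pn n) + rinf • x))) _).trans ?_
      refine add_le_add ((hLip (pn n) _ _).trans (le_of_eq ?_)) le_rfl
      rw [add_sub_add_left_eq_sub, ← sub_smul, norm_smul, Real.norm_eq_abs]
    have hlim0 : Tendsto (fun n => Λ 1 * (|r (ι n) - rinf| * ‖x‖) +
        ‖(M (σ₀ (pn n)))⁻¹ • u (t (σ₀ (pn n))) ((ν / M (σ₀ (pn n))) • (y (pn n) + rinf • x)) - W s (rinf • x)‖) atTop (𝓝 0) := by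
      have ha : Tendsto (fun n => |r (ι n) - rinf|) atTop (𝓝 0) := by
        have := (tendsto_iff_norm_sub_tendsto_zero.1 hr')
        simpa only [Real.norm_eq_abs] using this
      have hb : Tendsto (fun n => ‖(M (σ₀ (pn n)))⁻¹ • u (t (σ₀ (pn n))) ((ν / M (σ₀ (pn n))) • (y (pn n) + rinf • x)) -
          W s (rinf • x)‖) atTop (𝓝 0) := tendsto_iff_norm_sub_tendsto_zero.1 h2
      simpa using ((ha.mul_const ‖x‖).const_mul (Λ 1)).add hb
    exact squeeze_zero (fun n => norm_nonneg _) hbound hlim0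
  -- ### uniform derivative bounds for `Vn` and `V`
  have hWb : ∀ k : ℕ, ∃ Kk : ℝ, ∀ x, ‖iteratedFDeriv ℝ k (W s) x‖ ≤ Kk := fun k => hW.exists_norm_iteratedFDeriv_le_slice hs k
  choose Kk hKk using hWb
  have hVnb : ∀ k n x, ‖iteratedFDeriv ℝ k (Vn n) x‖ ≤ A k := by
    intro k n x
    have hM0 : 0 < M (ι n) := hMpos _
    have hl0 : 0 < lamn (ι n) := hlam0 _
    calc ‖iteratedFDeriv ℝ k (Vn n) x‖
        ≤ |(M (ι n))⁻¹| * |lamn (ι n)| ^ k * ‖iteratedFDeriv ℝ k (w n) (x₀ (ι n) + lamn (ι n) • x)‖ :=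
          norm_iteratedFDeriv_azoom_le (hwcd _) _ _ _ k x
      _ ≤ |(M (ι n))⁻¹| * |lamn (ι n)| ^ k * (A k * M (ι n) * (lamn (ι n))⁻¹ ^ k) :=
          mul_le_mul_of_nonneg_left (hReg (ι n) k _) (by positivity)
      _ = A k * ((M (ι n))⁻¹ * M (ι n)) * (lamn (ι n) * (lamn (ι n))⁻¹) ^ k := by
          rw [abs_of_pos (inv_pos.2 hM0), abs_of_pos hl0]; ring
      _ = A k := by rw [inv_mul_cancel₀ hM0.ne', mul_inv_cancel₀ hl0.ne', one_pow, mul_one, mul_one]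
  have hVb : ∀ k x, ‖iteratedFDeriv ℝ k V x‖ ≤ rinf ^ k * Kk k := by
    intro k x
    calc ‖iteratedFDeriv ℝ k V x‖ ≤ |sgn| * |rinf| ^ k * ‖iteratedFDeriv ℝ k (W s) (0 + rinf • x)‖ :=
          norm_iteratedFDeriv_azoom_le hWs _ _ _ k x
      _ ≤ 1 * rinf ^ k * Kk k := by
          rw [hsgnabs, abs_of_pos hrinfpos]
          exact mul_le_mul_of_nonneg_left (hKk k _) (by positivity)
      _ = rinf ^ k * Kk k := by ring
  have hbounds : ∀ k : ℕ, ∃ Ck : ℝ, (∀ n x, ‖iteratedFDeriv ℝ k (Vn n) x‖ ≤ Ck) ∧ ∀ x, ‖iteratedFDeriv ℝ k V x‖ ≤ Ck :=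
    fun k => ⟨max (A k) (rinf ^ k * Kk k), fun n x => (hVnb k n x).trans (le_max_left _ _),
      fun x => (hVb k x).trans (le_max_right _ _)⟩
  have hVncd : ∀ n, ContDiff ℝ (⊤ : ℕ∞) (Vn n) := fun n => contDiff_azoom (hwcd _) _ _ _
  have hVcd : ContDiff ℝ (⊤ : ℕ∞) V := contDiff_azoom hWs _ _ _
  -- ### heights
  have hVn1 : ∀ n x, ‖Vn n x‖ ≤ 1 := by
    intro n x
    show ‖azoom (M (ι n))⁻¹ (lamn (ι n)) (x₀ (ι n)) (w n) x‖ ≤ 1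
    rw [azoom_apply, norm_smul, Real.norm_eq_abs, abs_of_pos (inv_pos.2 (hMpos _))]
    calc (M (ι n))⁻¹ * ‖w n (x₀ (ι n) + lamn (ι n) • x)‖ ≤ (M (ι n))⁻¹ * M (ι n) :=
          mul_le_mul_of_nonneg_left (hwM _ _) (inv_nonneg.2 (hMpos _).le)
      _ = 1 := inv_mul_cancel₀ (hMpos _).ne'
  have hV1 : ∀ x, ‖V x‖ ≤ 1 := fun x =>
    le_of_tendsto' ((hptV x).norm) fun n => hVn1 n x
  -- ### robust local maximality of the limit
  have hmax : IsLocMaxIn kStar 1 V := by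
    intro θ φ hθ hφ
    have hφs : ContDiff ℝ (⊤ : ℕ∞) φ := hφ.1
    have hφc : HasCompactSupport φ := hφ.2.1
    -- the support inside a ball `B(0, ρ)`
    obtain ⟨ρ, hρ0, hρ⟩ := hφc.isCompact.isBounded.subset_ball_lt 0 (0 : EuclideanSpace ℝ (Fin 3))
    -- uniform convergence on the ball (equi-Lipschitz + pointwise)
    obtain ⟨C₁, hC₁n, hC₁⟩ := hbounds 1
    have hunif : ∀ ε > 0, ∀ᶠ n in atTop, ∀ z ∈ Metric.ball (0 : EuclideanSpace ℝ (Fin 3)) ρ, ‖(fun n z => Vn n z - V z) n z‖ < ε := by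
      refine eventually_norm_lt_of_equilipschitz (L := C₁ + C₁) (Eventually.of_forall fun n z hz z' hz' => ?_) fun z _ => ?_
      · have h1 := norm_sub_le_of_norm_iteratedFDeriv_one_le (hVncd n) (fun q _ => hC₁n n q) hz hz'
        have h2 := norm_sub_le_of_norm_iteratedFDeriv_one_le hVcd (fun q _ => hC₁ q) hz hz'
        calc ‖Vn n z - V z - (Vn n z' - V z')‖ = ‖(Vn n z - Vn n z') - (V z - V z')‖ := by congr 1; abel
          _ ≤ ‖Vn n z - Vn n z'‖ + ‖V z - V z'‖ := norm_sub_le _ _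
          _ ≤ C₁ * ‖z - z'‖ + C₁ * ‖z - z'‖ := add_le_add h1 h2
          _ = (C₁ + C₁) * ‖z - z'‖ := by ring
      · have h := (hptV z).sub_const (V z)
        rw [sub_self] at h
        exact h
    -- eventually: `θ/2`-close on the support, and the support inside the good ball
    have hρn : ∀ᶠ n : ℕ in atTop, ρ ≤ (ι n : ℝ) + 1 := by
      filter_upwards [eventually_ge_atTop ⌈ρ⌉₊] with n hn
      calc ρ ≤ ⌈ρ⌉₊ := Nat.le_ceil ρ
        _ ≤ n := by exact_mod_cast hn
        _ ≤ ι n := by exact_mod_cast hιn n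
        _ ≤ (ι n : ℝ) + 1 := by linarith
    have hgainn : ∀ᶠ n : ℕ in atTop, locGain kStar 1 (Vn n) φ ≤ 1 / ((n : ℝ) + 1) := by
      filter_upwards [hunif (θ / 2) (half_pos hθ), hρn] with n hn hρn'
      have hM0 : 0 < M (ι n) := hMpos _
      have hl0 : 0 < lamn (ι n) := hlam0 _
      -- `φ` is an admissible height-1 test of `Vn n`
      have hclose : ∀ z ∈ tsupport φ, ‖Vn n z - V z‖ ≤ θ / 2 := fun z hz => (hn z (hρ hz)).le
      have htestn : IsTestAt (Vn n) 1 φ := isTestAt_of_isTestIn hθ hφ (hVn1 n) hclose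
      -- the physical test
      set φ' : EuclideanSpace ℝ (Fin 3) → EuclideanSpace ℝ (Fin 3) :=
        azoom (M (ι n)) (lamn (ι n))⁻¹ (-((lamn (ι n))⁻¹ • x₀ (ι n))) φ with hφ'def
      have hφ' : IsTestAt (w n) (M (ι n)) φ' := isTestAt_azoom_inv hM0 hl0 htestn
      have hsub : tsupport φ' ⊆ Metric.ball (x₀ (ι n)) (((ι n : ℝ) + 1) * lamn (ι n)) :=
        (tsupport_azoom_inv_subset (M := M (ι n)) hl0 hρ).trans (Metric.ball_subset_ball (by gcongr))
      have hg := htest (ι n) φ' hφ' hsub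
      -- transport of the gain
      have hback : azoom (M (ι n))⁻¹ (lamn (ι n)) (x₀ (ι n)) φ' = φ := by
        have h := azoom_azoom_inv (inv_ne_zero hM0.ne') hl0.ne' (x₀ (ι n)) φ
        rwa [inv_inv] at h
      have hid : locGain kStar 1 (Vn n) φ = (M (ι n))⁻¹ ^ 3 * locGain (kStar * M (ι n)) (lamn (ι n)) (w n) φ' := by
        rw [← hback, hVndef, locGain_azoom (inv_ne_zero hM0.ne') hl0, div_inv_eq_mul, one_mul]
      rw [hid]
      calc (M (ι n))⁻¹ ^ 3 * locGain (kStar * M (ι n)) (lamn (ι n)) (w n) φ'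
          ≤ (M (ι n))⁻¹ ^ 3 * (1 / ((ι n : ℝ) + 1) * M (ι n) ^ 3) := mul_le_mul_of_nonneg_left hg (by positivity)
        _ = 1 / ((ι n : ℝ) + 1) := by field_simp
        _ ≤ 1 / ((n : ℝ) + 1) := by
            gcongr
            exact_mod_cast hιn n
    have hlimgain : Tendsto (fun n => locGain kStar 1 (Vn n) φ) atTop (𝓝 (locGain kStar 1 V φ)) :=
      tendsto_locGain_of_bounds kStar 1 hVncd hVcd hbounds hptV hφs hφc
    exact le_of_tendsto_of_tendsto hlimgain tendsto_one_div_add_atTop_nhds_zero_nat hgainn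
  -- ### thick vorticity at the origin (quantitative, at every `n`)
  have hlow : ∀ n, θ₀ ≤ ‖curl (Vn n) 0‖ := by
    intro n
    have hM0 : 0 < M (ι n) := hMpos _
    have hl0 : 0 < lamn (ι n) := hlam0 _
    rw [hVndef, curl_azoom, smul_zero, add_zero, norm_smul, Real.norm_eq_abs, abs_of_pos (mul_pos (inv_pos.2 hM0) hl0)]
    have h := hthick (ι n)
    calc θ₀ = (M (ι n))⁻¹ * lamn (ι n) * (θ₀ * M (ι n) * (lamn (ι n))⁻¹) := by field_simp
      _ ≤ (M (ι n))⁻¹ * lamn (ι n) * ‖curl (w n) (x₀ (ι n))‖ := mul_le_mul_of_nonneg_left h (by positivity)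
  -- ### good balls of the normalised slices at every scale `i ≤ n` (cell units)
  have hballs : ∀ n i : ℕ, i ≤ n → ∃ (c : EuclideanSpace ℝ (Fin 3)) (ρ : ℝ), ‖c‖ ≤ ρ / 2 ∧ (4 : ℝ) ^ i ≤ ρ ∧ ρ ≤ 2 * (4 : ℝ) ^ i ∧
      TwoThirds.IsGoodBall (Vn n) c ρ (Ktol / (i + 1)) := by
    intro n i hi
    have hM0 : 0 < M (ι n) := hMpos _
    have hl0 : 0 < lamn (ι n) := hlam0 _
    obtain ⟨c, ρ, hdist, h4, h24, hgood⟩ := htyp (ι n) i (by have := hιn n; omega)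
    refine ⟨(lamn (ι n))⁻¹ • (c - x₀ (ι n)), ρ, TwoThirds.norm_cell_centre_le hl0 hdist, h4, h24, ?_⟩
    rw [hVndef]
    exact TwoThirds.isGoodBall_azoom_of_isGoodBallAt hM0 hl0 hgood
  -- ### linear growth of the limit
  have hgrowthW : ∀ (x : EuclideanSpace ℝ (Fin 3)) (R : ℝ), 0 < R → ∫ z in Metric.ball x R, ‖W s z‖ ^ 2 ≤ A_F * R := by
    have htσ : Tendsto (fun k => t (σ₀ k)) atTop (𝓝[<] T) :=
      tendsto_nhdsWithin_iff.2 ⟨htT.comp hσ₀.tendsto_atTop, Eventually.of_forall fun k => (htI _).2⟩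
    refine FilamentSelection.growthTransfer ν A_F (fun k => u (t (σ₀ k))) (fun k => M (σ₀ k)) y pn (W s) hν
      (fun k => hMpos _) (fun k => (hfam.1 k).continuous) (fun k z => hfam.2.2.1 k z) (htσ.eventually hAF) hpn ?_
    intro z
    exact (hconv z).comp (hχ.comp hξ).tendsto_atTop
  have hgrowth : HasLinearGrowth (A_F / rinf ^ 2) V := by
    intro x R hR
    have hU : ∀ (x' : EuclideanSpace ℝ (Fin 3)) (ρ : ℝ), 0 < ρ → ∫ z in Metric.ball x' ρ, ‖W s z‖ ^ 2 ≤ A_F / rinf ^ 2 * rinf ^ 2 * ρ := by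
      intro x' ρ hρ
      rw [div_mul_cancel₀ _ (pow_ne_zero 2 hrinfpos.ne')]
      exact hgrowthW x' ρ hρ
    have h := FilamentSelection.ballEnergy_zoom_le (ν := rinf) (M := 1) (A := A_F / rinf ^ 2) hrinfpos one_pos hU 0 x hR
    refine le_trans (le_of_eq ?_) h
    refine setIntegral_congr_fun measurableSet_ball fun z _ => ?_
    simp only [hVdef, azoom_apply, norm_smul, Real.norm_eq_abs, hsgnabs, inv_one, div_one, abs_one, zero_add, one_mul]
  -- ### the remaining qualitative properties
  have hdivV : VectorCalculus.IsDivFree V := by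
    have h := ExtremiserTransience.isDivFree_zoom (hW.contDiff_slice hs) (hW.isDivFree hs) sgn rinf
    have e : V = fun x => sgn • W s (rinf • x) := by funext x; rw [hVdef, azoom_apply, zero_add]
    rw [e]; exact h
  have hanV : AnalyticOnNhd ℝ V Set.univ := by
    have hWan := hW.analyticOnNhd_slice_univ hs
    intro x _
    have e : V = fun x => sgn • W s (rinf • x) := by funext x; rw [hVdef, azoom_apply, zero_add]
    rw [e]
    have hlin : AnalyticAt ℝ (fun z : EuclideanSpace ℝ (Fin 3) => rinf • z) x := by
      have h : AnalyticAt ℝ (rinf • (id : EuclideanSpace ℝ (Fin 3) → EuclideanSpace ℝ (Fin 3))) x := analyticAt_id.const_smul (c := rinf)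
      exact h
    have hcomp' : AnalyticAt ℝ (fun z : EuclideanSpace ℝ (Fin 3) => W s (rinf • z)) x := (hWan (rinf • x) (Set.mem_univ _)).comp hlin
    have h2 : AnalyticAt ℝ (sgn • fun z : EuclideanSpace ℝ (Fin 3) => W s (rinf • z)) x := hcomp'.const_smul (c := sgn)
    exact h2
  -- ### conclusion: the limit class, and the doubling good balls of the limit extraction lemma
  obtain ⟨b₀, hb₀, hscales⟩ := TwoThirds.exists_doubling_goodBalls_of_limit hVncd hVcd hbounds hptV hθ₀ hlow hballs
  exact ⟨fun j => max 1 (rinf ^ j * Kk j), A_F / rinf ^ 2, V, Ktol, b₀, 4 ^ 10, fun j => le_max_left _ _,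
    div_pos hAFpos (pow_pos hrinfpos 2), ⟨hanV, hVcd, hdivV, hV1, fun j x => (hVb j x).trans (le_max_right _ _), hgrowth, hmax⟩,
    hKpos, hb₀, by norm_num, hscales⟩


end Assembly

end NearExtremalTransiencePerFlow.TwoThirds

end Summit.NavierStokesRegularity.NavierStokesRegularity.Theorems

end
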